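import Summits.BirchSwinnertonDyer.BirchSwinnertonDyer.Theorems.InertBadSignedBranchesInertBadAtThreeThirdDiagProduct
import HarnessLib

/-!
# The `χ₄`- and `χ̄₄`-twisted `3`-torsion sums of `E₁*` on `ℤi + ℤ` in closed form — pieces P4.1 / P4.2 of the STUB-PLAN for
# line `rubin_e1_inert_three`'s quartic stub (crux `InertBadAtThree`, stmt-BirchSwinnertonDyer-19225)

Summit `BirchSwinnertonDyer`, line of record `Lines/rubin_e1_inert_three.lean` v5 (lead `bsd-line-ibd-p1` g6), registered stub
`stub_plainOddNeronIntegralThreeQuartic`; ideator bsd-idea-18 g8's STUB-PLAN (`Cruxes/InertBadAtThree/STUB-PLAN-neronIntegralThreeQuartic-bsd-idea-18-g8.md`,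
`QUARTIC_STUB_PLAN_bsd_idea_18_g8.lean`), pieces **P4.1 `stub_quarticSum_eq`** and **P4.2 `stub_quarticConjSum_eq`** (statements VERBATIM with the
plan's abbreviations `threeTorsionQuarticSum` / `threeTorsionQuarticConjSum` and the Gaussian-lattice notations spelled out). With
`Λ = ℤi + ℤ`, `ϖ₀ = Γ(1/4)²/(2√(2π))`, `P₁ = ℘(1/3)`, `D(w) = 3℘(w)⁴ − 6ϖ₀⁴℘(w)² − ϖ₀⁸`, `χ₄` the quartic character of `ℤ[i]/3`
(`χ₄(±1) = 1`, `χ₄(±i) = −1`, `χ₄(±(1+i)) = −i`, `χ₄(±(1−i)) = i`):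

* `kroneckerE₁_quartic_three_torsion_sum` — `∑_v χ₄(3v) E₁*(w+v) = 6(√3 − 1)·P₁·(℘(w)² + ϖ₀⁴)·℘'(w)/D(w)`;
* `kroneckerE₁_quarticConj_three_torsion_sum` — `∑_v χ̄₄(3v) E₁*(w+v) = 2(3 − √3)·P₁·(3℘(w)² − ϖ₀⁴)·℘'(w)/D(w)`.

Proof = the tree's `GaussianLattice.kroneckerE₁_twisted_three_torsion_sum` (the quadratic character `κ = χ₄²`) up to the bracket: pair `v` with
`−v` (`kroneckerE₁_add_add_sub`), `℘(i/3) = −P₁`, `℘((1−i)/3) = −P₂` (`P₂ = ℘((1+i)/3)`), then the squares `P₁²`, `P₂²` (tree) and the product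
`P₁P₂ = −iϖ₀⁴/√3` (P4.0, `…ThirdDiagProduct.weierstrassP_third_mul_one_add_I_third`, p627741). In the coordinates `x = ℘/ϖ₀²`, `y = ℘'/(2ϖ₀³)`
of `y² = x³ − x` these are `4√2·3^{3/4}(x²+1)y/(3x⁴−6x²−1)` and `4√2·3^{1/4}(3x²−1)y/(3x⁴−6x²−1)`: the constants carry the `3`-adic orders `3/4`
and `1/4` that pay the Néron-period deficit `1 − k/4` on the Kodaira cells `k = 1` (III) and `k = 3` (III*) of the quartic twists `y² = x³ − Dx`,
`v₃(D) = k` (plan §0). Nothing about BSD, the crux or the stub is proved here beyond these two identities. No definitions; axioms standard.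
-/

set_option autoImplicit false
set_option linter.dupNamespace false

noncomputable section

open Complex Real PeriodPair
open scoped Real PeriodPair

namespace Summit.BirchSwinnertonDyer.BirchSwinnertonDyer.Theorems.InertBadSignedBranchesInertBadAtThreeQuarticClosedForms

open Literature.NumberTheory.EllipticCurves Literature.NumberTheory.EllipticCurves.GaussianLattice
open Summit.BirchSwinnertonDyer.BirchSwinnertonDyer.Theorems.InertBadSignedBranchesInertBadAtThreeThirdDiagProduct
  (weierstrassP_third_ne_zero weierstrassP_third_mul_one_add_I_third)

/-- **P4.1 — the `χ₄`-twisted `3`-torsion sum of `E₁*` in closed form**: for `w ∉ ℤi + ℤ` with `D(w) ≠ 0`,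
`[E₁*(w+⅓)+E₁*(w−⅓)] − [E₁*(w+i/3)+E₁*(w−i/3)] − i[E₁*(w+(1+i)/3)+E₁*(w−(1+i)/3)] + i[E₁*(w+(1−i)/3)+E₁*(w−(1−i)/3)]
 = 6(√3 − 1)·℘(1/3)·(℘(w)² + ϖ₀⁴)·℘'(w)/D(w)`. [folklore] -/
theorem kroneckerE₁_quartic_three_torsion_sum {w : ℂ}
    (hw : w ∉ (PeriodPair.ofUpperHalfPlane UpperHalfPlane.I).lattice)
    (hD : 3 * ℘[PeriodPair.ofUpperHalfPlane UpperHalfPlane.I] w ^ 4 -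
        6 * ((Real.Gamma (1 / 4) ^ 2 / (2 * Real.sqrt (2 * π)) : ℝ) : ℂ) ^ 4 *
          ℘[PeriodPair.ofUpperHalfPlane UpperHalfPlane.I] w ^ 2 -
        ((Real.Gamma (1 / 4) ^ 2 / (2 * Real.sqrt (2 * π)) : ℝ) : ℂ) ^ 8 ≠ 0) :
    kroneckerE₁ (w + 1 / 3) + kroneckerE₁ (w - 1 / 3) -
        (kroneckerE₁ (w + I / 3) + kroneckerE₁ (w - I / 3)) -
        I * (kroneckerE₁ (w + (1 + I) / 3) + kroneckerE₁ (w - (1 + I) / 3)) +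
        I * (kroneckerE₁ (w + (1 - I) / 3) + kroneckerE₁ (w - (1 - I) / 3)) =
      6 * ((Real.sqrt 3 : ℂ) - 1) * ℘[PeriodPair.ofUpperHalfPlane UpperHalfPlane.I] (1 / 3) *
          (℘[PeriodPair.ofUpperHalfPlane UpperHalfPlane.I] w ^ 2 +
            ((Real.Gamma (1 / 4) ^ 2 / (2 * Real.sqrt (2 * π)) : ℝ) : ℂ) ^ 4) *
          ℘'[PeriodPair.ofUpperHalfPlane UpperHalfPlane.I] w /
        (3 * ℘[PeriodPair.ofUpperHalfPlane UpperHalfPlane.I] w ^ 4 -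
          6 * ((Real.Gamma (1 / 4) ^ 2 / (2 * Real.sqrt (2 * π)) : ℝ) : ℂ) ^ 4 *
            ℘[PeriodPair.ofUpperHalfPlane UpperHalfPlane.I] w ^ 2 -
          ((Real.Gamma (1 / 4) ^ 2 / (2 * Real.sqrt (2 * π)) : ℝ) : ℂ) ^ 8) := by
  set P := ℘[PeriodPair.ofUpperHalfPlane UpperHalfPlane.I] w with hP
  set P' := ℘'[PeriodPair.ofUpperHalfPlane UpperHalfPlane.I] w with hP'
  set P₁ := ℘[PeriodPair.ofUpperHalfPlane UpperHalfPlane.I] (1 / 3) with hP₁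
  set P₂ := ℘[PeriodPair.ofUpperHalfPlane UpperHalfPlane.I] ((1 + I) / 3) with hP₂
  set ϖ : ℂ := ((Real.Gamma (1 / 4) ^ 2 / (2 * Real.sqrt (2 * π)) : ℝ) : ℂ) with hϖ
  set s : ℂ := (Real.sqrt 3 : ℂ) with hs
  have hs2 : s ^ 2 = 3 := by
    rw [hs, ← Complex.ofReal_pow, Real.sq_sqrt (by norm_num)]; norm_num
  have hs0 : s ≠ 0 := fun h ↦ by rw [h] at hs2; norm_num at hs2
  have h1 : P₁ ^ 2 = (3 + 2 * s) / 3 * ϖ ^ 4 := by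
    rw [hP₁, weierstrassP_third_sq, hs, hϖ]; push_cast; ring
  have h2 : P₂ ^ 2 = (3 - 2 * s) / 3 * ϖ ^ 4 := by
    rw [hP₂, weierstrassP_one_add_I_third_sq, hs, hϖ]; push_cast; ring
  have hP10 : P₁ ≠ 0 := weierstrassP_third_ne_zero
  have h12 : s * (P₁ * P₂) = -I * ϖ ^ 4 := by
    have h := weierstrassP_third_mul_one_add_I_third
    rw [← hP₁, ← hP₂, ← hϖ, ← hs] at h
    rw [h]; field_simp
  -- `D = 3 (P² - P₁²)(P² - P₂²)`
  have hfac : 3 * P ^ 4 - 6 * ϖ ^ 4 * P ^ 2 - ϖ ^ 8 = 3 * (P ^ 2 - P₁ ^ 2) * (P ^ 2 - P₂ ^ 2) := by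
    rw [h1, h2]; linear_combination (4 / 3 : ℂ) * ϖ ^ 8 * hs2
  have hD' : 3 * (P ^ 2 - P₁ ^ 2) * (P ^ 2 - P₂ ^ 2) ≠ 0 := hfac ▸ hD
  have hA : P ^ 2 - P₁ ^ 2 ≠ 0 := fun h ↦ hD' (by rw [h]; ring)
  have hB : P ^ 2 - P₂ ^ 2 ≠ 0 := fun h ↦ hD' (by rw [h]; ring)
  have hne1 : P - P₁ ≠ 0 := fun h ↦ hA (by linear_combination (P + P₁) * h)
  have hne1' : P + P₁ ≠ 0 := fun h ↦ hA (by linear_combination (P - P₁) * h)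
  have hne2 : P - P₂ ≠ 0 := fun h ↦ hB (by linear_combination (P + P₂) * h)
  have hne2' : P + P₂ ≠ 0 := fun h ↦ hB (by linear_combination (P - P₂) * h)
  -- the four pair sums
  have e1 := kroneckerE₁_add_add_sub hw one_third_notMem (sub_ne_zero.mp hne1)
  have e2 := kroneckerE₁_add_add_sub hw I_third_notMem (v := I / 3)
    (by rw [weierstrassP_I_third]; exact fun h ↦ hne1' (by rw [hP, hP₁]; linear_combination h))
  have e3 := kroneckerE₁_add_add_sub hw one_add_I_third_notMem (sub_ne_zero.mp hne2)
  have e4 := kroneckerE₁_add_add_sub hw one_sub_I_third_notMem (v := (1 - I) / 3)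
    (by rw [weierstrassP_one_sub_I_third]; exact fun h ↦ hne2' (by rw [hP, hP₂]; linear_combination h))
  rw [weierstrassP_I_third, ← hP, ← hP₁, ← hP', sub_neg_eq_add] at e2
  rw [weierstrassP_one_sub_I_third, ← hP, ← hP₂, ← hP', sub_neg_eq_add] at e4
  rw [← hP, ← hP₁, ← hP'] at e1
  rw [← hP, ← hP₂, ← hP'] at e3
  have key : kroneckerE₁ (w + 1 / 3) + kroneckerE₁ (w - 1 / 3) -
        (kroneckerE₁ (w + I / 3) + kroneckerE₁ (w - I / 3)) -
        I * (kroneckerE₁ (w + (1 + I) / 3) + kroneckerE₁ (w - (1 + I) / 3)) +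
        I * (kroneckerE₁ (w + (1 - I) / 3) + kroneckerE₁ (w - (1 - I) / 3)) =
      (P' / (P - P₁) - P' / (P + P₁)) - I * (P' / (P - P₂) - P' / (P + P₂)) := by
    linear_combination e1 - e2 - I * e3 + I * e4
  have eA : P' / (P - P₁) - P' / (P + P₁) = 2 * P₁ * P' / (P ^ 2 - P₁ ^ 2) := by
    rw [div_sub_div _ _ hne1 hne1', show (P - P₁) * (P + P₁) = P ^ 2 - P₁ ^ 2 by ring]
    congr 1; ring
  have eB : P' / (P - P₂) - P' / (P + P₂) = 2 * P₂ * P' / (P ^ 2 - P₂ ^ 2) := by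
    rw [div_sub_div _ _ hne2 hne2', show (P - P₂) * (P + P₂) = P ^ 2 - P₂ ^ 2 by ring]
    congr 1; ring
  -- the core identity (only `P₁²`, `P₂²`, `P₁P₂` enter)
  have hcore : P₁ * (P ^ 2 - P₂ ^ 2) - I * P₂ * (P ^ 2 - P₁ ^ 2) = (s - 1) * P₁ * (P ^ 2 + ϖ ^ 4) := by
    have hsP : s * P₁ ≠ 0 := mul_ne_zero hs0 hP10
    refine mul_left_cancel₀ hsP ?_
    linear_combination ((2 * s - 3) * P ^ 2) * h1 + (-s * P₁ ^ 2) * h2 + (I * (P₁ ^ 2 - P ^ 2)) * h12 +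
      (-P₁ ^ 2 * P ^ 2 - (1 / 3 : ℂ) * P₁ ^ 2 * ϖ ^ 4 + (4 / 3 : ℂ) * ϖ ^ 4 * P ^ 2) * hs2 +
      (ϖ ^ 4 * (P ^ 2 - P₁ ^ 2)) * Complex.I_sq
  rw [key, eA, eB, mul_div_assoc', div_sub_div _ _ hA hB, hfac, div_eq_div_iff (mul_ne_zero hA hB) hD']
  linear_combination (6 * P' * (P ^ 2 - P₁ ^ 2) * (P ^ 2 - P₂ ^ 2)) * hcore

/-- **P4.2 — the `χ̄₄`-twisted `3`-torsion sum of `E₁*` in closed form**: for `w ∉ ℤi + ℤ` with `D(w) ≠ 0`,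
`[E₁*(w+⅓)+E₁*(w−⅓)] − [E₁*(w+i/3)+E₁*(w−i/3)] + i[E₁*(w+(1+i)/3)+E₁*(w−(1+i)/3)] − i[E₁*(w+(1−i)/3)+E₁*(w−(1−i)/3)]
 = 2(3 − √3)·℘(1/3)·(3℘(w)² − ϖ₀⁴)·℘'(w)/D(w)`. [folklore] -/
theorem kroneckerE₁_quarticConj_three_torsion_sum {w : ℂ}
    (hw : w ∉ (PeriodPair.ofUpperHalfPlane UpperHalfPlane.I).lattice)
    (hD : 3 * ℘[PeriodPair.ofUpperHalfPlane UpperHalfPlane.I] w ^ 4 -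
        6 * ((Real.Gamma (1 / 4) ^ 2 / (2 * Real.sqrt (2 * π)) : ℝ) : ℂ) ^ 4 *
          ℘[PeriodPair.ofUpperHalfPlane UpperHalfPlane.I] w ^ 2 -
        ((Real.Gamma (1 / 4) ^ 2 / (2 * Real.sqrt (2 * π)) : ℝ) : ℂ) ^ 8 ≠ 0) :
    kroneckerE₁ (w + 1 / 3) + kroneckerE₁ (w - 1 / 3) -
        (kroneckerE₁ (w + I / 3) + kroneckerE₁ (w - I / 3)) +
        I * (kroneckerE₁ (w + (1 + I) / 3) + kroneckerE₁ (w - (1 + I) / 3)) -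
        I * (kroneckerE₁ (w + (1 - I) / 3) + kroneckerE₁ (w - (1 - I) / 3)) =
      2 * (3 - (Real.sqrt 3 : ℂ)) * ℘[PeriodPair.ofUpperHalfPlane UpperHalfPlane.I] (1 / 3) *
          (3 * ℘[PeriodPair.ofUpperHalfPlane UpperHalfPlane.I] w ^ 2 -
            ((Real.Gamma (1 / 4) ^ 2 / (2 * Real.sqrt (2 * π)) : ℝ) : ℂ) ^ 4) *
          ℘'[PeriodPair.ofUpperHalfPlane UpperHalfPlane.I] w /
        (3 * ℘[PeriodPair.ofUpperHalfPlane UpperHalfPlane.I] w ^ 4 -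
          6 * ((Real.Gamma (1 / 4) ^ 2 / (2 * Real.sqrt (2 * π)) : ℝ) : ℂ) ^ 4 *
            ℘[PeriodPair.ofUpperHalfPlane UpperHalfPlane.I] w ^ 2 -
          ((Real.Gamma (1 / 4) ^ 2 / (2 * Real.sqrt (2 * π)) : ℝ) : ℂ) ^ 8) := by
  set P := ℘[PeriodPair.ofUpperHalfPlane UpperHalfPlane.I] w with hP
  set P' := ℘'[PeriodPair.ofUpperHalfPlane UpperHalfPlane.I] w with hP'
  set P₁ := ℘[PeriodPair.ofUpperHalfPlane UpperHalfPlane.I] (1 / 3) with hP₁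
  set P₂ := ℘[PeriodPair.ofUpperHalfPlane UpperHalfPlane.I] ((1 + I) / 3) with hP₂
  set ϖ : ℂ := ((Real.Gamma (1 / 4) ^ 2 / (2 * Real.sqrt (2 * π)) : ℝ) : ℂ) with hϖ
  set s : ℂ := (Real.sqrt 3 : ℂ) with hs
  have hs2 : s ^ 2 = 3 := by
    rw [hs, ← Complex.ofReal_pow, Real.sq_sqrt (by norm_num)]; norm_num
  have hs0 : s ≠ 0 := fun h ↦ by rw [h] at hs2; norm_num at hs2
  have h1 : P₁ ^ 2 = (3 + 2 * s) / 3 * ϖ ^ 4 := by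
    rw [hP₁, weierstrassP_third_sq, hs, hϖ]; push_cast; ring
  have h2 : P₂ ^ 2 = (3 - 2 * s) / 3 * ϖ ^ 4 := by
    rw [hP₂, weierstrassP_one_add_I_third_sq, hs, hϖ]; push_cast; ring
  have hP10 : P₁ ≠ 0 := weierstrassP_third_ne_zero
  have h12 : s * (P₁ * P₂) = -I * ϖ ^ 4 := by
    have h := weierstrassP_third_mul_one_add_I_third
    rw [← hP₁, ← hP₂, ← hϖ, ← hs] at h
    rw [h]; field_simp
  have hfac : 3 * P ^ 4 - 6 * ϖ ^ 4 * P ^ 2 - ϖ ^ 8 = 3 * (P ^ 2 - P₁ ^ 2) * (P ^ 2 - P₂ ^ 2) := by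
    rw [h1, h2]; linear_combination (4 / 3 : ℂ) * ϖ ^ 8 * hs2
  have hD' : 3 * (P ^ 2 - P₁ ^ 2) * (P ^ 2 - P₂ ^ 2) ≠ 0 := hfac ▸ hD
  have hA : P ^ 2 - P₁ ^ 2 ≠ 0 := fun h ↦ hD' (by rw [h]; ring)
  have hB : P ^ 2 - P₂ ^ 2 ≠ 0 := fun h ↦ hD' (by rw [h]; ring)
  have hne1 : P - P₁ ≠ 0 := fun h ↦ hA (by linear_combination (P + P₁) * h)
  have hne1' : P + P₁ ≠ 0 := fun h ↦ hA (by linear_combination (P - P₁) * h)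
  have hne2 : P - P₂ ≠ 0 := fun h ↦ hB (by linear_combination (P + P₂) * h)
  have hne2' : P + P₂ ≠ 0 := fun h ↦ hB (by linear_combination (P - P₂) * h)
  have e1 := kroneckerE₁_add_add_sub hw one_third_notMem (sub_ne_zero.mp hne1)
  have e2 := kroneckerE₁_add_add_sub hw I_third_notMem (v := I / 3)
    (by rw [weierstrassP_I_third]; exact fun h ↦ hne1' (by rw [hP, hP₁]; linear_combination h))
  have e3 := kroneckerE₁_add_add_sub hw one_add_I_third_notMem (sub_ne_zero.mp hne2)
  have e4 := kroneckerE₁_add_add_sub hw one_sub_I_third_notMem (v := (1 - I) / 3)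
    (by rw [weierstrassP_one_sub_I_third]; exact fun h ↦ hne2' (by rw [hP, hP₂]; linear_combination h))
  rw [weierstrassP_I_third, ← hP, ← hP₁, ← hP', sub_neg_eq_add] at e2
  rw [weierstrassP_one_sub_I_third, ← hP, ← hP₂, ← hP', sub_neg_eq_add] at e4
  rw [← hP, ← hP₁, ← hP'] at e1
  rw [← hP, ← hP₂, ← hP'] at e3
  have key : kroneckerE₁ (w + 1 / 3) + kroneckerE₁ (w - 1 / 3) -
        (kroneckerE₁ (w + I / 3) + kroneckerE₁ (w - I / 3)) +
        I * (kroneckerE₁ (w + (1 + I) / 3) + kroneckerE₁ (w - (1 + I) / 3)) -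
        I * (kroneckerE₁ (w + (1 - I) / 3) + kroneckerE₁ (w - (1 - I) / 3)) =
      (P' / (P - P₁) - P' / (P + P₁)) + I * (P' / (P - P₂) - P' / (P + P₂)) := by
    linear_combination e1 - e2 + I * e3 - I * e4
  have eA : P' / (P - P₁) - P' / (P + P₁) = 2 * P₁ * P' / (P ^ 2 - P₁ ^ 2) := by
    rw [div_sub_div _ _ hne1 hne1', show (P - P₁) * (P + P₁) = P ^ 2 - P₁ ^ 2 by ring]
    congr 1; ring
  have eB : P' / (P - P₂) - P' / (P + P₂) = 2 * P₂ * P' / (P ^ 2 - P₂ ^ 2) := by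
    rw [div_sub_div _ _ hne2 hne2', show (P - P₂) * (P + P₂) = P ^ 2 - P₂ ^ 2 by ring]
    congr 1; ring
  have hcore : 3 * (P₁ * (P ^ 2 - P₂ ^ 2) + I * P₂ * (P ^ 2 - P₁ ^ 2)) =
      (3 - s) * P₁ * (3 * P ^ 2 - ϖ ^ 4) := by
    have hsP : s * P₁ ≠ 0 := mul_ne_zero hs0 hP10
    refine mul_left_cancel₀ hsP ?_
    linear_combination ((9 - 6 * s) * P ^ 2) * h1 + (-3 * s * P₁ ^ 2) * h2 + (3 * I * (P ^ 2 - P₁ ^ 2)) * h12 +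
      (3 * P₁ ^ 2 * P ^ 2 + P₁ ^ 2 * ϖ ^ 4 - 4 * ϖ ^ 4 * P ^ 2) * hs2 +
      (-3 * ϖ ^ 4 * (P ^ 2 - P₁ ^ 2)) * Complex.I_sq
  rw [key, eA, eB, mul_div_assoc', div_add_div _ _ hA hB, hfac, div_eq_div_iff (mul_ne_zero hA hB) hD']
  linear_combination (2 * P' * (P ^ 2 - P₁ ^ 2) * (P ^ 2 - P₂ ^ 2)) * hcore

end Summit.BirchSwinnertonDyer.BirchSwinnertonDyer.Theorems.InertBadSignedBranchesInertBadAtThreeQuarticClosedForms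

end
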